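import Summits.ABC.IUTFork.Repair.RHReqsidePairPK3CM2764Frey
import HarnessLib

/-!
# D-0122 AXIS B, NAMED PAIR «P-k3c1/2-k5mu1/2» (row PK3CM12): THE KERNEL FACE, BY NAME — the declared map `c = ½` at the worked place and, per datum, the single
# deciding comparison `K_L1,mod ≥ ½·M_mod` on FREY133 + HEX79, as corollaries of the sibling row PK3CM2764's files (`μ₀ ∈ {27/64, ½}` there; `μ₀ = ½` alone here)

COMPUTED TABLE ROW RE-DERIVED ≠ theorem about IUT. PROOF-ONLY file (0 definitions; abc-iut-rh-lead g3 R63 (B)(2): one file per row, defs imported only). Row keyed by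
`wake/KEY-abc-iut-rh-typ-9-PK3CM12.md` (owner abc-iut-rh-lead g4; RQ7 any aud seat / abc-iut-reqb-ref-1); bytes typed by abc-iut-rh-typ-10 GEN 11 (author of the sibling
files p516979 `Repair/RHReqsidePairPK3CM2764.lean` + p517950 `Repair/RHReqsidePairPK3CM2764Frey.lean`; rh-lead g3 R68 B353 / R70: «PK3CM12 … (b) settled by name by
p516979/p517950 — then PK3CM12 = a thin file citing them»); rung LADDER-ABC:A2.RESCUE.H. NOTHING is re-derived here: no bed numeral is restated, no `decide` runs over a bed;
every bed statement below is the `μ₀ = ½` member of the sibling theorem's «∀ μ₀ ∈ [27/64, ½]», extracted by the generic `half_of_targets` and DISPLAYED by `#check` (the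
statements are written `type_of% (half_of_targets _ ‹sibling theorem›)` so that the 212 data literals are cited, not copied; `#print` shows each in full).
THE ROW OF RECORD (`plan/rescue/R-H/ROUND3/REQB-TABLE.tsv` v1 b8ac679ede5d795b = reqb-ref-1 REQB-SIGNED-ref-1-v1 a23349b525227fe7; spec `REQB-SPEC.md` v0.2 §6 = R46; the
two rows VERBATIM): «P-k3c1/2-k5mu1/2 · FREY133 · 133 · k1=print k2=print c=1/2 cD=1 pk=j+1 rnd=floor mu0=1/2 · MEETS · 133/133 · 1.4950 · 1.4674 · 1.1149 · 0.5575 · no ·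
REDUCES-STRONGLY · 0.2793 · 0.2397 · 7 · 51 · 0.565 · 2.889 · 2.212 · 1024.0 · bed-height only (WINDOW-PERSISTENT 0/133) · inherited(K_L1mod<=K_L1print 133/133) ·
INCONSISTENT · k3_c=1/2: INCONSISTENT (rf-2 k3.c=½: Q3-05 IV p.10 + Q3-06 IV p.11 (radii are equalities of Z_p-modules)); k5=1/2: DEFINABLE (rf-1 k5.μ½: λ-link [L4]
(l=107: λ = 482); outcome C_Θ ≥ −λ) · KEPT-WITH-NEW-THEORY-TAG (not R8-eligible: partner lowers μ_L1,min) — INCONSISTENT · yes · SIGN» and «P-k3c1/2-k5mu1/2 · HEX79 · 79 ·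
(same knobs) · MEETS · 79/79 · 1.7443 · 1.8323 · 1.5490 · 0.7745 · no · VANISHES · 0.0000 · 0.0000 · 8 · 78 · 0.882 · 6.392 · 5.168 · 1090.6 · bed-height only
(WINDOW-PERSISTENT 0/79) · inherited(K_L1mod<=K_L1print 79/79) · INCONSISTENT · (same cell) · KEPT-WITH-NEW-THEORY-TAG (not R8-eligible …) — INCONSISTENT · yes · SIGN».
(Columns: point_id · bed · n · knobs · COUNT_WORD · n_rho>=1 · rho_pooled · rho_lowmed · rho_min · muL1_min · R8_partner_raises_mu_min · T_word · Tmod/T_pooled · Tmod/T_med ·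
j0_med · j0_p90 · share_full · crossR_sx_med · crossR_sx_min · crossR_hx_max · WINDOW · cone · CONSISTENCY · consistency_loci · VERDICT · AB_agree · SIGN.)
CONSISTENCY WORD with loci ids, verbatim (abc-iut-reqb-rf-2 `LOCI-TABLE-PartII-rf-2.md` 16962e2ffdef058e, .md rows 6 / 9 / 10 = `.tsv` 4a4e8af55ab5f4bf l.7 / l.10 / l.11;
ids resolve in `LOCI-rf-2.tsv` 6c7aff5d032053f6 and rf-1 `loci.tsv`): row 6 «k3 c ∈ {0, ½} on (R_in, R_out) (Ind2 tightness)» = «INCONSISTENT ⇒ NEW-THEORY (H)»: IV p.10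
[Q3-05]; IV p.11 [Q3-06]; III p.104 [Q3-04]; III p.154 [Q3-02, Q3-15]; IV p.29 [Q3-08] — «the radii are THEOREMS about log_p («the “⊆’s” are equalities when p > 2 and
e_i ≤ p−2»), not parameters»; row 9 «k5 μ₀ ∈ {27/64, ½, ¾} (μ₀ = 1 print)» = «DEFINABLE, CONSISTENT = print's generalized Θ×μ_LGP-link»: III p.186 [L4a–e]; III p.159
[L14a–c]; III p.174 [L8b] — «q-side exponent λ = 1 + (1 − μ₀)(l(l+1) − 12)/12» (here `μ₀ = ½`, `l = 107`: `λ = 1 + ½·962 = 482`, the cell's numeral); row 10 «named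
pairs / triples» = «word = CONJUNCTION of the components». Located ≠ adjudicated.
THE DECLARED MAP AND THE LEDGER are those of part 1 of the sibling (module docstring of `Repair/RHReqsidePairPK3CM2764.lean`, not repeated): doubled margin
`2·margin_j(½) = (2m_q − (j+1)R_out) − 2e_w·⌊(j²·2m_q − j·2D − (j+1)R_in)/(2e_w)⌋` (`twiceMargin_nonneg_iff` = `HullCellδ (2e_w) (2m_q) j (2D) R_in R_out` of p507493),
place ledger `(p, e_w, MM_w, 2DD_w)` as ONE inline lambda, `M = Σ_w MM_w·ln p/(e_w l⋆)`, `K_L1 = Σ_w (MM_w − DD_w)·ln p/(e_w l⋆)`; the per-place integers do NOT depend on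
`μ₀`: engine A (abc-iut-reqb-lp-1) `REQB-A-v1/v411/A_reqb_places_PAIRS.tsv.gz` 1069699756551edc carries ONE w-side place table for the family `P-k3c1/2-·` (filed under
point P-k3c1/2-k5mu27/64; no separate `μ₀ = ½` place rows), and `A_reqb_data_PAIRS.tsv.gz` 61f5a4c2481f9597 lists identical `M_formal` / `K_L1_formal` / `mu_L1` for the
two points at all 432 (datum, side) rows — so the two rows share (a) and the ledgers and differ only in the target `μ₀` of (b). SEAT-SIDE READ of that data file (< 10
CPU-s, this seat): point P-k3c1/2-k5mu1/2, side w: `meets_L1` = 133/133 (FREY) and 79/79 (HEX), `min mu_L1` = 0.5575 / 0.7745 ⇒ `ρ_min(½)` = 1.1149 / 1.5490 = the cells.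
WHAT IS PROVED (namespace `Summit.ABC.IUTFork.Repair.RH.ReqsidePairPK3CM12`):
* §1 `half_of_targets` (generic, [folklore]): a bed statement «`∀ d ∈ B, ∀ μ₀ ∈ [27/64, ½], μ₀·M(d) ≤ K_L1(d)`» (the conclusion shape of the sibling's `meets_of_certs`)
  gives «`∀ d ∈ B, ½·M(d) ≤ K_L1(d) ∧ reqThreshold ½ M(d) K_L1(d) = 0`» (p508156's currency: «ratio of record `ρ(½) ≥ 1`», R46 (P2)).
* §2 (a) THE WORKED PLACE (FREY `p = 7`, `l = 107`: `e_w 1605, m_q 210, D 1604, R_in 268, R_out −4472, l⋆ 53`): the licensed-label SET under `c = ½` is `[1, …, 19]`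
  as a list identity (`worked_licensed_eq`, `j₀,mod = 19`, 19 of 53 labels; the per-label form is the sibling's `worked_twiceMargins_iff`, the boundary pair p509351
  `ReqsideWorkedPlace.cHalf_boundary`, print's `{1,…,31}` = `print_boundary_iff`); the worked DATUM at `μ₀ = ½` (`workedDatum_meets_half`; engine A `ρ(½) = 1.310`,
  `μ_L1 = 0.65477`).
* §3 (b) HEX79 at `μ₀ = ½`: `hex_half_1 … hex_half_6` = the `½` members of the sibling's `hex_meets_1 … _6` (20+15+13+10+11+10 = 79 data; engine `ρ_min(½) = 1.5490`
  at `k = 15, l = 13`, sidecar row HEX 71) — the row's «79/79».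
* §4 (b) FREY133 at `μ₀ = ½`: `frey_half_1 … frey_half_12` = the `½` members of `frey_meets_1 … _12` (10+11+11+11+11+10+12+12+12+11+12+10 = 133 data; engine
  `ρ_min(½) = 1.1149` at sidecar row FREY 45, `l = 11`) — the row's «133/133». Data order = sidecar `HOME/staging/RH/abc-iut-rh-typ-10/gen10/PK3CM2764_data_order.tsv`
  32f5a78babe570a6.
HONEST SCOPE (as in the sibling). The numerals are the engines' certified per-place integers (A ≡ B: reqb-ref-1 CERT-AB-ALL-v411 41a7fc45c940dd1b): COMPUTED ≠ PROVED —
the theorems certify the cell arithmetic and the real-log comparison AT the listed numerals; numeral ↔ datum is the kit certificate. `c = ½`, `μ₀ = ½` are HYPOTHETICAL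
parameter settings of OUR cell currency (consistency word above: INCONSISTENT ⇒ NEW-THEORY (H) ∧ DEFINABLE; the pair = CONJUNCTION); nothing here asserts that abc is
proved or refuted, or that [IUTchIII] Cor. 3.12 / [IUTchIV] Thm. 1.10 holds or fails at any datum; no side is taken on any author; typed ≠ proved; computed ≠ proved;
located ≠ adjudicated; signed ≠ endorsed. [claim: Mochizuki2012, status: disputed] for every IUT locution.
[cite: Mochizuki2012, IUTchIV Prop. 1.2 p. 10–11, Thm. 1.10 Step (v) p. 27–29; IUTchIII Cor. 3.12 p. 173–174, Rmk. 3.12.1 (ii) p. 186]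
-/

namespace Summit.ABC.IUTFork.Repair.RH.ReqsidePairPK3CM12

open Summit.ABC.IUTFork.Repair.RH.ReqsideWeightLaws Summit.ABC.IUTFork.Repair.RH.ReqsidePairPK3CM2764

/-! ## §1. From «both targets `μ₀ ∈ {27/64, ½}`» to the row's single target `μ₀ = ½` -/

/-- **Generic extraction.** For a bed list `B` of data `(l⋆, [(p, e_w, m_q, D, R_in, R_out)])` with the place ledger computed in the kernel exactly as in the sibling's
`meets_of_certs`: if every datum MEETS at both targets `μ₀ ∈ {27/64, ½}`, then every datum satisfies the row-PK3CM12 comparison `½·M ≤ K_L1`, equivalently (p508156)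
`reqThreshold ½ M K_L1 = 0` («`ρ(½) ≥ 1`»). [folklore] -/
theorem half_of_targets (B : List (ℕ × List (ℕ × ℕ × ℤ × ℤ × ℤ × ℤ)))
    (h : ∀ d ∈ B,
      let T : List (ℕ × ℕ × ℤ × ℤ) := d.2.map fun ⟨p, e, m, D, ri, ro⟩ => (p, e, m * (((d.1 : ℤ) * ((d.1 : ℤ) - 1) * (2 * (d.1 : ℤ) + 5)) / 6),
        ((List.range' 1 d.1).map fun j => max 0 (-((2 * m - ((j : ℤ) + 1) * ro) - 2 * (e : ℤ) * (((j : ℤ) ^ 2 * (2 * m) - (j : ℤ) * (2 * D) - ((j : ℤ) + 1) * ri) / (2 * (e : ℤ)))))).sum)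
      ∀ μ₀ ∈ ([27 / 64, 1 / 2] : List ℝ), μ₀ * (T.map fun t => (t.2.2.1 : ℝ) * Real.log t.1 / ((t.2.1 : ℝ) * d.1)).sum
        ≤ (T.map fun t => ((t.2.2.1 : ℝ) - (t.2.2.2 : ℝ) / 2) * Real.log t.1 / ((t.2.1 : ℝ) * d.1)).sum) :
    ∀ d ∈ B,
    let T : List (ℕ × ℕ × ℤ × ℤ) := d.2.map fun ⟨p, e, m, D, ri, ro⟩ => (p, e, m * (((d.1 : ℤ) * ((d.1 : ℤ) - 1) * (2 * (d.1 : ℤ) + 5)) / 6),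
      ((List.range' 1 d.1).map fun j => max 0 (-((2 * m - ((j : ℤ) + 1) * ro) - 2 * (e : ℤ) * (((j : ℤ) ^ 2 * (2 * m) - (j : ℤ) * (2 * D) - ((j : ℤ) + 1) * ri) / (2 * (e : ℤ)))))).sum)
    (1 / 2 : ℝ) * (T.map fun t => (t.2.2.1 : ℝ) * Real.log t.1 / ((t.2.1 : ℝ) * d.1)).sum
        ≤ (T.map fun t => ((t.2.2.1 : ℝ) - (t.2.2.2 : ℝ) / 2) * Real.log t.1 / ((t.2.1 : ℝ) * d.1)).sum ∧
      reqThreshold (1 / 2) ((T.map fun t => (t.2.2.1 : ℝ) * Real.log t.1 / ((t.2.1 : ℝ) * d.1)).sum)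
        ((T.map fun t => ((t.2.2.1 : ℝ) - (t.2.2.2 : ℝ) / 2) * Real.log t.1 / ((t.2.1 : ℝ) * d.1)).sum) = 0 := by
  intro d hd
  have h2 := h d hd (1 / 2) (by simp)
  exact ⟨h2, (reqThreshold_eq_zero_iff _ _ _).2 h2⟩

/-! ## §2. (a) The worked place (FREY `p = 7`, `l = 107`) under `c = ½`, and its datum at `μ₀ = ½` -/

/-- **`j₀,mod = 19` as a list identity**: the labels `j ∈ [1, …, 53]` licensed under `c = ½` at the worked place (`2·margin_j(½) ≥ 0`, place integers
`e_w 1605, m_q 210, D 1604, R_in 268, R_out −4472`) are EXACTLY the list `[1, …, 19]` (19 of `l⋆ = 53` labels; `seg = 1`). Per-label form: the sibling's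
`ReqsidePairPK3CM2764.worked_twiceMargins_iff`; boundary pair `19 ∈ / 20 ∉`: p509351 `ReqsideWorkedPlace.cHalf_boundary`; referee third engine `wp2.py` fb7cb557b479a521
«c = ½ ↦ 19». [folklore arithmetic at the table's numerals] -/
theorem worked_licensed_eq :
    (List.range' 1 53).filter (fun j => decide (0 ≤ ((2 * (210 : ℤ) - ((j : ℤ) + 1) * (-4472 : ℤ)) - 2 * ((1605 : ℕ) : ℤ) *
      (((j : ℤ) ^ 2 * (2 * (210 : ℤ)) - (j : ℤ) * (2 * (1604 : ℤ)) - ((j : ℤ) + 1) * (268 : ℤ)) / (2 * ((1605 : ℕ) : ℤ))))))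
      = List.range' 1 19 := by
  decide +kernel

/-- **The worked DATUM satisfies row PK3CM12's comparison** (`l = 107`, `l⋆ = 53`; nine places at `p = 3, 5, 7, 43, 53, 67, 83, 353, 22381`, the sibling's
`workedDatum_meets` at `μ₀ = ½`): `½·M ≤ K_L1 ∧ reqThreshold ½ M K_L1 = 0`; engine A: `M = 1464.017` nats, `K_L1 = 958.595`, `μ_L1 = 0.65477`, `ρ(½) = 1.310`. Statement =
`half_of_targets` at that datum list (displayed by `#check workedDatum_meets_half`). [folklore arithmetic at the table's numerals] -/
theorem workedDatum_meets_half : type_of% (half_of_targets _ workedDatum_meets) :=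
  half_of_targets _ workedDatum_meets

/-! ## §3. (b) HEX79 at `μ₀ = ½`: the row's «79/79», by name -/

/-- **HEX79 at `μ₀ = ½`, part 1/6** = the `½` member of the sibling's `hex_meets_1` (data 1–20 of the sidecar order, 88 places): `∀ d ∈ ⟨those data⟩, ½·M(d) ≤ K_L1(d) ∧
reqThreshold ½ M(d) K_L1(d) = 0`. Numerals = ENGINE A, cited not copied (COMPUTED ≠ PROVED). [folklore arithmetic at the table's numerals] -/
theorem hex_half_1 : type_of% (half_of_targets _ hex_meets_1) := half_of_targets _ hex_meets_1

/-- **HEX79 at `μ₀ = ½`, part 2/6** = the `½` member of `hex_meets_2` (data 21–35, 88 places). [folklore arithmetic at the table's numerals] -/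
theorem hex_half_2 : type_of% (half_of_targets _ hex_meets_2) := half_of_targets _ hex_meets_2

/-- **HEX79 at `μ₀ = ½`, part 3/6** = the `½` member of `hex_meets_3` (data 36–48, 83 places). [folklore arithmetic at the table's numerals] -/
theorem hex_half_3 : type_of% (half_of_targets _ hex_meets_3) := half_of_targets _ hex_meets_3

/-- **HEX79 at `μ₀ = ½`, part 4/6** = the `½` member of `hex_meets_4` (data 49–58, 82 places). [folklore arithmetic at the table's numerals] -/
theorem hex_half_4 : type_of% (half_of_targets _ hex_meets_4) := half_of_targets _ hex_meets_4

/-- **HEX79 at `μ₀ = ½`, part 5/6** = the `½` member of `hex_meets_5` (data 59–69, 85 places). [folklore arithmetic at the table's numerals] -/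
theorem hex_half_5 : type_of% (half_of_targets _ hex_meets_5) := half_of_targets _ hex_meets_5

/-- **HEX79 at `μ₀ = ½`, part 6/6** = the `½` member of `hex_meets_6` (data 70–79, 83 places; contains the bed's tightest datum `k = 15, l = 13`, sidecar row HEX 71,
engine `μ_L1 = 0.7745`, `ρ(½) = 1.5490` = the row's `rho_min` on HEX79). [folklore arithmetic at the table's numerals] -/
theorem hex_half_6 : type_of% (half_of_targets _ hex_meets_6) := half_of_targets _ hex_meets_6

/-! ## §4. (b) FREY133 at `μ₀ = ½`: the row's «133/133», by name -/

/-- **FREY133 at `μ₀ = ½`, part 1/12** = the `½` member of the sibling's `frey_meets_1` (data 1–10 of the sidecar order; datum 1 = the worked place's datum):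
`∀ d ∈ ⟨those data⟩, ½·M(d) ≤ K_L1(d) ∧ reqThreshold ½ M(d) K_L1(d) = 0`. Numerals = ENGINE A, cited not copied. [folklore arithmetic at the table's numerals] -/
theorem frey_half_1 : type_of% (half_of_targets _ frey_meets_1) := half_of_targets _ frey_meets_1

/-- **FREY133 at `μ₀ = ½`, part 2/12** = the `½` member of `frey_meets_2` (data 11–21). [folklore arithmetic at the table's numerals] -/
theorem frey_half_2 : type_of% (half_of_targets _ frey_meets_2) := half_of_targets _ frey_meets_2

/-- **FREY133 at `μ₀ = ½`, part 3/12** = the `½` member of `frey_meets_3` (data 22–32). [folklore arithmetic at the table's numerals] -/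
theorem frey_half_3 : type_of% (half_of_targets _ frey_meets_3) := half_of_targets _ frey_meets_3

/-- **FREY133 at `μ₀ = ½`, part 4/12** = the `½` member of `frey_meets_4` (data 33–43). [folklore arithmetic at the table's numerals] -/
theorem frey_half_4 : type_of% (half_of_targets _ frey_meets_4) := half_of_targets _ frey_meets_4

/-- **FREY133 at `μ₀ = ½`, part 5/12** = the `½` member of `frey_meets_5` (data 44–54; contains the bed's tightest datum, sidecar row FREY 45, `l = 11`, engine
`μ_L1 = 0.5575`, `ρ(½) = 1.1149` = the row's `rho_min` on FREY133). [folklore arithmetic at the table's numerals] -/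
theorem frey_half_5 : type_of% (half_of_targets _ frey_meets_5) := half_of_targets _ frey_meets_5

/-- **FREY133 at `μ₀ = ½`, part 6/12** = the `½` member of `frey_meets_6` (data 55–64). [folklore arithmetic at the table's numerals] -/
theorem frey_half_6 : type_of% (half_of_targets _ frey_meets_6) := half_of_targets _ frey_meets_6

/-- **FREY133 at `μ₀ = ½`, part 7/12** = the `½` member of `frey_meets_7` (data 65–76). [folklore arithmetic at the table's numerals] -/
theorem frey_half_7 : type_of% (half_of_targets _ frey_meets_7) := half_of_targets _ frey_meets_7

/-- **FREY133 at `μ₀ = ½`, part 8/12** = the `½` member of `frey_meets_8` (data 77–88). [folklore arithmetic at the table's numerals] -/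
theorem frey_half_8 : type_of% (half_of_targets _ frey_meets_8) := half_of_targets _ frey_meets_8

/-- **FREY133 at `μ₀ = ½`, part 9/12** = the `½` member of `frey_meets_9` (data 89–100). [folklore arithmetic at the table's numerals] -/
theorem frey_half_9 : type_of% (half_of_targets _ frey_meets_9) := half_of_targets _ frey_meets_9

/-- **FREY133 at `μ₀ = ½`, part 10/12** = the `½` member of `frey_meets_10` (data 101–111). [folklore arithmetic at the table's numerals] -/
theorem frey_half_10 : type_of% (half_of_targets _ frey_meets_10) := half_of_targets _ frey_meets_10

/-- **FREY133 at `μ₀ = ½`, part 11/12** = the `½` member of `frey_meets_11` (data 112–123). [folklore arithmetic at the table's numerals] -/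
theorem frey_half_11 : type_of% (half_of_targets _ frey_meets_11) := half_of_targets _ frey_meets_11

/-- **FREY133 at `μ₀ = ½`, part 12/12** = the `½` member of `frey_meets_12` (data 124–133). [folklore arithmetic at the table's numerals] -/
theorem frey_half_12 : type_of% (half_of_targets _ frey_meets_12) := half_of_targets _ frey_meets_12

end Summit.ABC.IUTFork.Repair.RH.ReqsidePairPK3CM12
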